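import Summits.CriticalPhenomena.PercolationContinuityZ3.Theorems.PercNearOneGluingNoHeavyLowerTailLossyStarTransfer
import HarnessLib

/-!
# `NoHeavyLowerTail` (stmt-CriticalPhenomena-4575) — the SIGNED STAR TRANSFER: Kozma–Nitzan's Lemma 3(ii) and
# Lemma 5 in quantitative form (gain when the witness is the more fragile vertex, loss bounded by the
# disconnection ratio when it is not)

Support file (engine seat `prim-cplus-engine` g5; `--supports stmt-CriticalPhenomena-4575`).  No definitions, no
named facts, no sorries.

Kozma–Nitzan's Lemma 3(ii) / Lemma 5 (tree: `KozmaNitzan2024_lemma3_ii_cluster`, `LossyStar.lemma5_add`) are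
ONE-SIDED: the defect of fragility of the witness is paid additively (`+ δ`, `+ δ·P(σ_B)`), and nothing is gained
when the witness is strictly MORE fragile than the port.  The BHK two-cluster inequalities behind them give more:

* `SignedStar.lemma3_ii_signed` — **quantitative Lemma 3(ii)**: for a monotone vertex-set property `P`, vertices
  `a₁, a₂`, `D = {a₁ ↮ a₂}` and a decreasing event `Q` read on the (edge) cluster of `a₁`,
  `μ(D) · (μ(P(C(a₁)) ∩ Q) − μ(P(C(a₂)) ∩ Q)) ≤ (μ(P(C(a₁))) − μ(P(C(a₂)))) · μ(D ∩ Q)`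
  — with NO sign hypothesis: a witness `a₂` whose cluster has `P` more often than `a₁`'s makes the right side
  negative (a gain), and in the other direction the loss carries the factor `μ(D ∩ Q)/μ(D) ≤ 1`.
* `SignedStar.real_union_signed` — the gluing step with the signed slack.
* `SignedStar.lemma5_signed` — **quantitative Lemma 5**: for `a, v ≠ 0`, `v ∈ B`,
  `P_{G∖0}(a ↮ v) · [P(P(C(a)), σ_B) − P(P(C(0)), σ_B)] ≤ P(σ_B) · [P_{G∖0}(P(C(a))) − P_{G∖0}(P(C(v)))] · P_{G∖0}(a ↮ B)`.
  In the crux's vocabulary (`P(S) = (j+1 ≤ |S ∩ A|)`, complements): for every star pattern `B` of the observer,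
  every open port `v ∈ B` and every relay `c`,
  `P_{G∖0}(c ↮ v)·[μ(σ_B, 0 small) − μ(σ_B, c small)] ≤ μ(σ_B)·[Φ'(v) − Φ'(c)]·P_{G∖0}(c ↮ B)`,
  i.e. per pocket state the glued-port block is less often small than `c` by at least
  `(Φ'(c) − Φ'(v))·P(c ↮ B ∣ c ↮ v)` when `c` is the more fragile, and more often by at most
  `(Φ'(v) − Φ'(c))·P(c ↮ B ∣ c ↮ v)` otherwise (engine memo `ENGINE-g5.md` §2: verified on 95 084 exact
  instances; the signed rows are what the depth-2 step of the Kozma–Nitzan induction trades across patterns).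
-/

noncomputable section

namespace Summit.CriticalPhenomena.PercolationContinuityZ3.Theorems

open MeasureTheory Set Literature.Probability.LatticeModels Literature.Probability.Percolation
open Literature.Probability.Percolation.KNPreFKG
open scoped Classical BigOperators

namespace SignedStar

variable {V : Type*} [Fintype V]

/-- **Quantitative Lemma 3(ii)** (monotone `{0,1}`-valued cluster property, decreasing `Q` read on the edge
cluster of `a₁`): `μ(D)·(μ(P(C(a₁)) ∩ Q) − μ(P(C(a₂)) ∩ Q)) ≤ (μ(P(C(a₁))) − μ(P(C(a₂))))·μ(D ∩ Q)` with
`D = {a₁ ↮ a₂}`.  On `Dᶜ` the two clusters coincide; on `D`, BHK Thm. 1.3 (increasing × decreasing in `C_{a₁}`)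
and Thm. 1.5 (increasing in `C_{a₂}` × decreasing in `C_{a₁}`), subtracted.
[cite: KozmaNitzan2024, Lemma 3(ii) (pp. 6–7); VandenbergHaggstromKahn2005, Thms. 1.3, 1.5 (pp. 6–7)] -/
theorem lemma3_ii_signed (w : Sym2 V → unitInterval) (a₁ a₂ : V) (P : Set V → Prop)
    (hP : ∀ S T : Set V, S ⊆ T → P S → P T) {𝒬 : Set (Set (Sym2 V))} (h𝒬 : IsLowerSet 𝒬) :
    (prodBernoulli w).real {ω : BondConfig V | ¬ (openGraph ω).Reachable a₁ a₂} *
        ((prodBernoulli w).real ({ω | P (openCluster ω a₁)} ∩ {ω | openEdgeCluster ω a₁ ∈ 𝒬}) -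
          (prodBernoulli w).real ({ω | P (openCluster ω a₂)} ∩ {ω | openEdgeCluster ω a₁ ∈ 𝒬})) ≤
      ((prodBernoulli w).real {ω | P (openCluster ω a₁)} - (prodBernoulli w).real {ω | P (openCluster ω a₂)}) *
        (prodBernoulli w).real ({ω : BondConfig V | ¬ (openGraph ω).Reachable a₁ a₂} ∩
          {ω | openEdgeCluster ω a₁ ∈ 𝒬}) := by
  classical
  by_cases h12 : a₁ = a₂
  · subst h12
    simp only [sub_self, mul_zero, zero_mul, le_refl]
  set μ := prodBernoulli w with hμ
  set X₁ : Set (BondConfig V) := {ω | P (openCluster ω a₁)} with hX₁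
  set X₂ : Set (BondConfig V) := {ω | P (openCluster ω a₂)} with hX₂
  set Q : Set (BondConfig V) := {ω | openEdgeCluster ω a₁ ∈ 𝒬} with hQ
  set D : Set (BondConfig V) := {ω | ¬ (openGraph ω).Reachable a₁ a₂} with hD
  -- on `Dᶜ` the two events agree (same cluster)
  have hagree : X₁ ∩ Dᶜ = X₂ ∩ Dᶜ := by
    ext ω
    simp only [mem_inter_iff, mem_compl_iff, mem_setOf_eq, not_not, hX₁, hX₂, hD]
    constructor
    · rintro ⟨h1, h2⟩
      exact ⟨by rwa [← openCluster_eq_of_reachable h2], h2⟩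
    · rintro ⟨h1, h2⟩
      exact ⟨by rwa [openCluster_eq_of_reachable h2], h2⟩
  have hagreeQ : X₁ ∩ Q ∩ Dᶜ = X₂ ∩ Q ∩ Dᶜ := by
    rw [inter_right_comm, hagree, inter_right_comm]
  have hsplit : ∀ A : Set (BondConfig V), μ.real A = μ.real (A ∩ D) + μ.real (A ∩ Dᶜ) := by
    intro A
    rw [← measureReal_inter_add_sdiff (s := A) (MeasurableSet.of_discrete : MeasurableSet D),
      Set.sdiff_eq]
  -- differences live on `D`
  have hdiffX : μ.real X₁ - μ.real X₂ = μ.real (D ∩ X₁) - μ.real (D ∩ X₂) := by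
    rw [hsplit X₁, hsplit X₂, hagree, inter_comm X₁ D, inter_comm X₂ D]; ring
  have hdiffXQ : μ.real (X₁ ∩ Q) - μ.real (X₂ ∩ Q) =
      μ.real (D ∩ (X₁ ∩ Q)) - μ.real (D ∩ (X₂ ∩ Q)) := by
    rw [hsplit (X₁ ∩ Q), hsplit (X₂ ∩ Q), hagreeQ, inter_comm (X₁ ∩ Q) D, inter_comm (X₂ ∩ Q) D]; ring
  -- the events in edge-cluster form
  have hX₁e : X₁ = {ω | openEdgeCluster ω a₁ ∈ {C : Set (Sym2 V) | P {a | a = a₁ ∨ ∃ e ∈ C, a ∈ e}}} :=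
    setOf_prop_openCluster_eq a₁ P
  have hX₂e : X₂ = {ω | openEdgeCluster ω a₂ ∈ {C : Set (Sym2 V) | P {a | a = a₂ ∨ ∃ e ∈ C, a ∈ e}}} :=
    setOf_prop_openCluster_eq a₂ P
  -- (1) one-cluster BHK: `μ(D)·μ(D ∩ X₁ ∩ Q) ≤ μ(D ∩ X₁)·μ(D ∩ Q)`
  have hD1 : {ω : BondConfig V | ∀ x ∈ ({a₂} : Set V), ¬ (openGraph ω).Reachable a₁ x} = D := by
    ext ω
    simp [hD]
  have h1 := bhk_one_upper_lower w a₁ ({a₂} : Set V) (by simpa using h12)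
    (isUpperSet_clusterPropFamily a₁ P hP) h𝒬
  rw [hD1, ← hX₁e] at h1
  -- (3) two-cluster BHK: `μ(D ∩ X₂)·μ(D ∩ Q) ≤ μ(D)·μ(D ∩ X₂ ∩ Q)`
  have hD2 : {ω : BondConfig V | ¬ (openGraph ω).Reachable a₂ a₁} = D := by
    ext ω
    simp only [mem_setOf_eq, hD]
    exact not_congr ⟨SimpleGraph.Reachable.symm, SimpleGraph.Reachable.symm⟩
  have h3 := bhk_two_upper_lower w a₂ a₁ (Ne.symm h12) (isUpperSet_clusterPropFamily a₂ P hP) h𝒬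
  rw [hD2, ← hX₂e] at h3
  -- subtract
  rw [hdiffX, hdiffXQ]
  nlinarith [h1, h3]

/-- **The gluing step with the signed slack.**  For a monotone vertex-set property `P`, vertices `a, v` with
`v ∈ B`, and every set `Z` of configurations containing `{P(C(v))}`:
`μ(a ↮ v) · μ(({P(C(a))} ∩ {a ↮ B}) ∪ ({a ↔ B} ∩ Z)) ≤ μ(a ↮ v) · μ(Z) + (μ(P(C(a))) − μ(P(C(v)))) · μ(a ↮ B)`.
[cite: KozmaNitzan2024, Lemma 3(ii) (pp. 6–7) and Lemma 5 (p. 13)] -/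
theorem real_union_signed (w : Sym2 V → unitInterval) (a v : V) (B : Set V) (hvB : v ∈ B)
    (P : Set V → Prop) (hP : ∀ S T : Set V, S ⊆ T → P S → P T) (Z : Set (BondConfig V))
    (hvZ : {ω : BondConfig V | P (openCluster ω v)} ⊆ Z) :
    (prodBernoulli w).real {ω : BondConfig V | ¬ (openGraph ω).Reachable a v} *
        (prodBernoulli w).real (({ω : BondConfig V | P (openCluster ω a)} ∩
            {ω | ∀ u ∈ B, ¬ (openGraph ω).Reachable a u}) ∪
          ({ω | ∃ u ∈ B, (openGraph ω).Reachable a u} ∩ Z)) ≤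
      (prodBernoulli w).real {ω : BondConfig V | ¬ (openGraph ω).Reachable a v} *
          (prodBernoulli w).real Z +
        ((prodBernoulli w).real {ω | P (openCluster ω a)} - (prodBernoulli w).real {ω | P (openCluster ω v)}) *
          (prodBernoulli w).real {ω : BondConfig V | ∀ u ∈ B, ¬ (openGraph ω).Reachable a u} := by
  classical
  set μ := prodBernoulli w with hμ
  set X : Set (BondConfig V) := {ω | P (openCluster ω a)} with hX
  set Y : Set (BondConfig V) := {ω | ∃ u ∈ B, (openGraph ω).Reachable a u} with hY
  set N : Set (BondConfig V) := {ω | ∀ u ∈ B, ¬ (openGraph ω).Reachable a u} with hN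
  set D : Set (BondConfig V) := {ω : BondConfig V | ¬ (openGraph ω).Reachable a v} with hD
  -- `N ⊆ D` since `v ∈ B`
  have hND : D ∩ N = N := by
    refine inter_eq_right.2 fun ω hω => ?_
    exact hω v hvB
  -- quantitative Lemma 3(ii) with `Q = {a ↮ B}`
  have L3 : μ.real D * (μ.real (X ∩ N) - μ.real ({ω : BondConfig V | P (openCluster ω v)} ∩ N)) ≤
      (μ.real X - μ.real {ω : BondConfig V | P (openCluster ω v)}) * μ.real N := by
    have key := lemma3_ii_signed w a v P hP (isLowerSet_disconnFamily a B)
    rw [← setOf_forall_not_reachable_eq, ← hD, hND] at key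
    exact key
  -- `{P(C(v)), a ↮ B} ⊆ Z ∩ N`
  have h2 : μ.real ({ω : BondConfig V | P (openCluster ω v)} ∩ N) ≤ μ.real (Z ∩ N) :=
    measureReal_mono fun ω ⟨h1, hn⟩ => ⟨hvZ h1, hn⟩
  -- `Y ∩ Z ⊆ Z ∖ N`
  have hYN : Y ∩ Z ⊆ Z ∩ Nᶜ := by
    rintro ω ⟨⟨u, hu, hau⟩, hz⟩
    exact ⟨hz, fun hn => hn u hu hau⟩
  have hsplit : μ.real Z = μ.real (Z ∩ N) + μ.real (Z ∩ Nᶜ) := by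
    rw [← measureReal_inter_add_sdiff (s := Z) (MeasurableSet.of_discrete : MeasurableSet N),
      Set.sdiff_eq]
  have hU : μ.real ((X ∩ N) ∪ (Y ∩ Z)) ≤ μ.real (X ∩ N) + μ.real (Y ∩ Z) := measureReal_union_le _ _
  have hYZ : μ.real (Y ∩ Z) ≤ μ.real (Z ∩ Nᶜ) := measureReal_mono hYN
  have hD0 : 0 ≤ μ.real D := measureReal_nonneg
  calc μ.real D * μ.real ((X ∩ N) ∪ (Y ∩ Z))
      ≤ μ.real D * (μ.real (X ∩ N) + μ.real (Z ∩ Nᶜ)) :=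
        mul_le_mul_of_nonneg_left (hU.trans (by linarith)) hD0
    _ = μ.real D * μ.real (X ∩ N) + μ.real D * μ.real (Z ∩ Nᶜ) := by ring
    _ ≤ (μ.real D * μ.real ({ω : BondConfig V | P (openCluster ω v)} ∩ N) +
          (μ.real X - μ.real {ω : BondConfig V | P (openCluster ω v)}) * μ.real N) +
          μ.real D * μ.real (Z ∩ Nᶜ) := by linarith [L3]
    _ ≤ (μ.real D * μ.real (Z ∩ N) +
          (μ.real X - μ.real {ω : BondConfig V | P (openCluster ω v)}) * μ.real N) +
          μ.real D * μ.real (Z ∩ Nᶜ) := by nlinarith [h2, hD0]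
    _ = μ.real D * μ.real Z +
          (μ.real X - μ.real {ω : BondConfig V | P (openCluster ω v)}) * μ.real N := by
        rw [hsplit]; ring

/-- **Kozma–Nitzan's Lemma 5, signed / quantitative form** (monotone `{0,1}`-valued cluster property).  Let
`a, v ≠ 0`, `v ∈ B`, `σ_B` the event that the open pairs at `0` are exactly those to `B`, and write `P'` for
percolation on `G ∖ {0}` (events `openConnIn {0}ᶜ`).  Then
`P'(a ↮ v) · [P(P(C(a)), σ_B) − P(P(C(0)), σ_B)] ≤ P(σ_B) · [P'(P(C(a))) − P'(P(C(v)))] · P'(a ↮ B)`.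
When `P'(P(C(a))) ≤ P'(P(C(v)))` (the hypothesis of Lemma 5) the right side is `≤ 0` and the printed Lemma 5
follows with a quantitative GAIN; otherwise the loss is the excess times `P'(a ↮ B) ≤ P'(a ↮ v)`, sharper than
the additive slack of `LossyStar.lemma5_add`.  Proof: the tree's Lemma 5 proof with `real_union_signed` in place
of the one-sided gluing step, and the independence of the star of `0` from the pairs off `0`.
[cite: KozmaNitzan2024, Lemma 5 (p. 13), Lemma 3 (pp. 6–7)] -/
theorem lemma5_signed (w : Sym2 V → unitInterval)
    (o a v : V) (B : Set V) (P : Set V → Prop) (hP : ∀ S T : Set V, S ⊆ T → P S → P T)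
    (hao : a ≠ o) (hvo : v ≠ o) (hvB : v ∈ B) :
    (prodBernoulli w).real {ω : BondConfig V | ω ∉ openConnIn ({o}ᶜ : Set V) a v} *
        ((prodBernoulli w).real ({ω | P (openCluster ω a)} ∩ starEvent o B) -
          (prodBernoulli w).real ({ω | P (openCluster ω o)} ∩ starEvent o B)) ≤
      (prodBernoulli w).real (starEvent o B) *
        (((prodBernoulli w).real {ω | P {y | ω ∈ openConnIn ({o}ᶜ : Set V) a y}} -
            (prodBernoulli w).real {ω | P {y | ω ∈ openConnIn ({o}ᶜ : Set V) v y}}) *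
          (prodBernoulli w).real {ω : BondConfig V | ∀ u ∈ B, u ≠ o → ω ∉ openConnIn ({o}ᶜ : Set V) a u}) := by
  classical
  set μ := prodBernoulli w with hμ
  -- the graph `G ∖ {0}`
  set S : Set V := {o}ᶜ with hS
  haveI : Fintype S := Fintype.ofFinite S
  set f : S → V := Subtype.val with hf
  set w' : Sym2 S → unitInterval := w ∘ Sym2.map f with hw'
  set μ' := prodBernoulli w' with hμ'
  have haS : a ∈ S := mem_compl_singleton_iff.2 hao
  have hvS : v ∈ S := mem_compl_singleton_iff.2 hvo
  set a' : S := ⟨a, haS⟩ with ha'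
  set v' : S := ⟨v, hvS⟩ with hv'
  set B' : Set S := {u | (u : V) ∈ B} with hB'
  have hvB' : v' ∈ B' := hvB
  set P' : Set S → Prop := fun T => P (Subtype.val '' T) with hP'
  have hP'mono : ∀ T T' : Set S, T ⊆ T' → P' T → P' T' :=
    fun T T' hTT' hT => hP _ _ (image_mono hTT') hT
  -- the events on `G ∖ {0}`
  set X : Set (BondConfig S) := {ω' | P' (openCluster ω' a')} with hX
  set Xv : Set (BondConfig S) := {ω' | P' (openCluster ω' v')} with hXv
  set N : Set (BondConfig S) := {ω' | ∀ u ∈ B', ¬ (openGraph ω').Reachable a' u} with hN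
  set Y : Set (BondConfig S) := {ω' | ∃ u ∈ B', (openGraph ω').Reachable a' u} with hY
  set D : Set (BondConfig S) := {ω' | ¬ (openGraph ω').Reachable a' v'} with hD
  set Z : Set (BondConfig S) :=
    {ω' | P ({o} ∪ Subtype.val '' {y' | ∃ u ∈ B', (openGraph ω').Reachable u y'})} with hZ
  have hvZ : Xv ⊆ Z := by
    intro ω' hω'
    refine hP _ _ ?_ hω'
    rintro y ⟨y', hy', rfl⟩
    exact Or.inr ⟨y', ⟨v', hvB', hy'⟩, rfl⟩
  -- identification of the four `G ∖ {0}` quantities with events of `G`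
  have eX : μ.real (restrictConfig f ⁻¹' X) = μ.real {ω | P {y | ω ∈ openConnIn ({o}ᶜ : Set V) a y}} := by
    rw [hX, hP', hf, preimage_setOf_prop_openCluster]
  have eXv : μ.real (restrictConfig f ⁻¹' Xv) = μ.real {ω | P {y | ω ∈ openConnIn ({o}ᶜ : Set V) v y}} := by
    rw [hXv, hP', hf, preimage_setOf_prop_openCluster]
  have eD : restrictConfig f ⁻¹' D = {ω : BondConfig V | ω ∉ openConnIn ({o}ᶜ : Set V) a v} := by
    ext ω
    rw [mem_preimage, hD, mem_setOf_eq, mem_setOf_eq, hf, reachable_restrictConfig_val_iff]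
  have eN : restrictConfig f ⁻¹' N =
      {ω : BondConfig V | ∀ u ∈ B, u ≠ o → ω ∉ openConnIn ({o}ᶜ : Set V) a u} := by
    ext ω
    rw [mem_preimage, hN, mem_setOf_eq, mem_setOf_eq]
    constructor
    · intro h u huB huo hau
      have huS : u ∈ S := mem_compl_singleton_iff.2 huo
      exact h ⟨u, huS⟩ huB ((reachable_restrictConfig_val_iff S ω a' ⟨u, huS⟩).2 (hf ▸ hau))
    · intro h u huB hau
      have huo : (u : V) ≠ o := mem_compl_singleton_iff.1 u.2
      exact h u huB huo (by rw [hf] at hau; exact (reachable_restrictConfig_val_iff S ω a' u).1 hau)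
  -- the signed gluing step on `G ∖ {0}`, transported to `G`
  have hWZ : μ.real (restrictConfig f ⁻¹' D) * μ.real (restrictConfig f ⁻¹' ((X ∩ N) ∪ (Y ∩ Z))) ≤
      μ.real (restrictConfig f ⁻¹' D) * μ.real (restrictConfig f ⁻¹' Z) +
        (μ.real (restrictConfig f ⁻¹' X) - μ.real (restrictConfig f ⁻¹' Xv)) *
          μ.real (restrictConfig f ⁻¹' N) := by
    rw [hf, real_preimage_restrictConfig_val, real_preimage_restrictConfig_val,
      real_preimage_restrictConfig_val, real_preimage_restrictConfig_val, real_preimage_restrictConfig_val,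
      real_preimage_restrictConfig_val]
    exact real_union_signed w' a' v' B' hvB' P' hP'mono Z hvZ
  -- `{P(C(a))} ∩ σ ⊆ σ ∩ pull-back of (X ∩ N) ∪ (Y ∩ Z)`   (verbatim from `LossyStar.lemma5_add`)
  have hsub1 : {ω : BondConfig V | P (openCluster ω a)} ∩ starEvent o B ⊆
      starEvent o B ∩ restrictConfig f ⁻¹' ((X ∩ N) ∪ (Y ∩ Z)) := by
    rintro ω ⟨hPa, hσ⟩
    refine ⟨hσ, ?_⟩
    rw [mem_preimage]
    by_cases hn : ∀ u ∈ B, u ≠ o → ω ∉ openConnIn ({o}ᶜ : Set V) a u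
    · left
      refine ⟨?_, ?_⟩
      · change P' (openCluster (restrictConfig f ω) a')
        rw [hP']
        change P (Subtype.val '' openCluster (restrictConfig Subtype.val ω) a')
        rw [KNPreFKG.image_openCluster_restrictConfig]
        refine hP _ _ (fun x hx => ?_) hPa
        have hxo : x ≠ o := by
          rintro rfl
          obtain ⟨p⟩ := (hx : (openGraph ω).Reachable a x).symm
          obtain ⟨u', hu'B, hu'o, hu'a⟩ := (walk_decomp hσ p hao).2 rfl
          obtain ⟨h1, h2, hr⟩ := hu'a
          exact hn u' hu'B hu'o ⟨h2, h1, hr.symm⟩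
        obtain ⟨p⟩ := (hx : (openGraph ω).Reachable a x)
        rcases (walk_decomp hσ p hxo).1 hao with h | ⟨⟨u, huB, huo, hau⟩, _⟩
        · exact h
        · exact absurd hau (hn u huB huo)
      · intro u huB hau
        have huo : (u : V) ≠ o := mem_compl_singleton_iff.1 u.2
        exact hn u huB huo ((reachable_restrictConfig_val_iff S ω a' u).1 hau)
    · right
      push Not at hn
      obtain ⟨u, huB, huo, hau⟩ := hn
      have huS : u ∈ S := mem_compl_singleton_iff.2 huo
      refine ⟨⟨⟨u, huS⟩, huB, (reachable_restrictConfig_val_iff S ω a' ⟨u, huS⟩).2 hau⟩, ?_⟩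
      change P ({o} ∪ Subtype.val '' {y' | ∃ u ∈ B', (openGraph (restrictConfig f ω)).Reachable u y'})
      refine hP _ _ (fun x hx => ?_) hPa
      by_cases hxo : x = o
      · exact Or.inl hxo
      · right
        have hxS : x ∈ S := mem_compl_singleton_iff.2 hxo
        obtain ⟨p⟩ := (hx : (openGraph ω).Reachable a x)
        rcases (walk_decomp hσ p hxo).1 hao with h | ⟨_, ⟨u', hu'B, hu'o, hu'x⟩⟩
        · refine ⟨⟨x, hxS⟩, ⟨⟨u, huS⟩, huB, ?_⟩, rfl⟩
          have h1 : (openGraph (restrictConfig f ω)).Reachable a' ⟨u, huS⟩ :=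
            (reachable_restrictConfig_val_iff S ω a' ⟨u, huS⟩).2 hau
          have h2 : (openGraph (restrictConfig f ω)).Reachable a' ⟨x, hxS⟩ :=
            (reachable_restrictConfig_val_iff S ω a' ⟨x, hxS⟩).2 h
          exact h1.symm.trans h2
        · have hu'S : u' ∈ S := mem_compl_singleton_iff.2 hu'o
          exact ⟨⟨x, hxS⟩, ⟨⟨u', hu'S⟩, hu'B,
            (reachable_restrictConfig_val_iff S ω ⟨u', hu'S⟩ ⟨x, hxS⟩).2 hu'x⟩, rfl⟩
  -- `σ ∩ pull-back of Z ⊆ {P(C(0))} ∩ σ`   (verbatim from `LossyStar.lemma5_add`)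
  have hsub2 : starEvent o B ∩ restrictConfig f ⁻¹' Z ⊆
      {ω : BondConfig V | P (openCluster ω o)} ∩ starEvent o B := by
    rintro ω ⟨hσ, hz⟩
    refine ⟨?_, hσ⟩
    rw [mem_preimage] at hz
    change P ({o} ∪ Subtype.val '' {y' | ∃ u ∈ B', (openGraph (restrictConfig f ω)).Reachable u y'}) at hz
    refine hP _ _ (fun x hx => ?_) hz
    rcases hx with hxo | ⟨y', ⟨u, huB, huy⟩, rfl⟩
    · rw [mem_singleton_iff] at hxo
      subst hxo
      exact mem_openCluster_self ω x
    · have huy' : (openGraph ω).Reachable (u : V) y' :=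
        reachable_of_openConnIn ((reachable_restrictConfig_val_iff S ω u y').1 huy)
      have huo : (u : V) ≠ o := mem_compl_singleton_iff.1 u.2
      have hou : s(o, (u : V)) ∈ ω := ((mem_starEvent_iff o B ω).1 hσ u huo).2 huB
      have hadj : (openGraph ω).Adj o u := (openGraph_adj ω o u).2 ⟨hou, huo.symm⟩
      exact hadj.reachable.trans huy'
  -- assemble with the independence of `σ` from the pairs off `0`
  have hσ0 : 0 ≤ μ.real (starEvent o B) := measureReal_nonneg
  have hDnn : 0 ≤ μ.real (restrictConfig f ⁻¹' D) := measureReal_nonneg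
  have i1 : μ.real ({ω | P (openCluster ω a)} ∩ starEvent o B) ≤
      μ.real (starEvent o B) * μ.real (restrictConfig f ⁻¹' ((X ∩ N) ∪ (Y ∩ Z))) := by
    rw [← real_starEvent_inter_preimage w o B _]
    exact measureReal_mono hsub1
  have i2 : μ.real (starEvent o B) * μ.real (restrictConfig f ⁻¹' Z) ≤
      μ.real ({ω | P (openCluster ω o)} ∩ starEvent o B) := by
    rw [← real_starEvent_inter_preimage w o B Z]
    exact measureReal_mono hsub2
  rw [← eD, ← eN, ← eX, ← eXv]
  have key := mul_le_mul_of_nonneg_left hWZ hσ0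
  nlinarith [i1, i2, key, hDnn, hσ0, mul_nonneg hDnn hσ0]

end SignedStar

end Summit.CriticalPhenomena.PercolationContinuityZ3.Theorems

end
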